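import Mathlib
import Literature.Analysis.FluidPDE.PoincareBall
import Literature.Analysis.FluidPDE.SuitableWeakRescaling
import Literature.Analysis.FluidPDE.SereginSverakPressureProofs
import Literature.Analysis.FluidPDE.BlowupFarField
import Literature.Analysis.FluidPDE.SereginSverak2002VertexBlowupLimit
import Literature.Analysis.FluidPDE.NSSuitableESS
import Literature.Analysis.FluidPDE.ESSLocalHolderHolds
import Literature.Analysis.FluidPDE.ESSLocalHolderBlowupLimit
import Literature.Analysis.FluidPDE.LocalTypeIScaling
import Literature.Analysis.FluidPDE.LocalTypeIPersistenceHolds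
import Literature.Analysis.FluidPDE.LocalTypeICongr
import Literature.Analysis.FluidPDE.LeraySuitableWeakSolutions
import Literature.Analysis.FluidPDE.NSWeakStrongUniquenessHolds
import Literature.Analysis.FluidPDE.TaoLocalisationHolds
import Literature.Analysis.FluidPDE.TaoLocalisationProofs
import Literature.Analysis.FluidPDE.KatoMaximalTimeSingular
import Literature.Analysis.FluidPDE.TypeIRateScaledEnergyBound
import Literature.Analysis.FluidPDE.SereginSverak2002PressureLowerBoundProofs
import Literature.Analysis.FluidPDE.NSLerayHopfABCScaling
import Literature.Analysis.FluidPDE.NSTimeRescaleClassical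
import Literature.Analysis.FluidPDE.NSViscosityRescaling
import Literature.Analysis.FluidPDE.TypeIAncientMildRescale
import Literature.Analysis.FluidPDE.SelfSimilar
import Literature.Analysis.FluidPDE.AncientAxisymmetricTypeILiouville
import Literature.Analysis.FluidPDE.CKNLocalEnergyEstimate
import Literature.Analysis.FluidPDE.CKNPressureEstimate
import Literature.Analysis.FluidPDE.CKNUnforcedOneScaleRRS
import Literature.Analysis.FluidPDE.CKNLocalRegularityRRSPressure
import Literature.Analysis.FluidPDE.RusinSverakSingularityStabilityEpsilon
import Literature.Analysis.FluidPDE.CKNScalingExtras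
import Literature.Analysis.FluidPDE.CKNLocalRegularityRRSStep3
import Literature.Analysis.FluidPDE.PineauVicolOneSliceProofs
import Literature.Analysis.FluidPDE.TsaiLocalEnergyProofs
import Summits.NavierStokesRegularity.NavierStokesRegularity.Theorems.ExtremalTypeIConstantSmallConstantLiouville
import Summits.NavierStokesRegularity.NavierStokesRegularity.Theorems.TypeIQuarterGateScarEnvelopeTypeISatelliteTowerClosure
import Summits.NavierStokesRegularity.NavierStokesRegularity.Theorems.TypeIQuarterGateScarEnvelopeTypeISatelliteTowerExclusions
import Summits.NavierStokesRegularity.NavierStokesRegularity.Theorems.TypeIQuarterGateScarEnvelopeTypeISatelliteTowerRateMinimal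
import Summits.NavierStokesRegularity.NavierStokesRegularity.Theorems.TypeIQuarterGateScarEnvelopeTypeISatelliteTowerRateFloor
import Summits.NavierStokesRegularity.NavierStokesRegularity.Theorems.TypeIQuarterGateScarEnvelopeTypeISatelliteTowerUniformFloor

/-!
# Satellite tower for crux `ScarEnvelopeTypeI` (stmt-NavierStokesRegularity-23843) — Part Q: (T∞) is inside the closure engine; THE UNIFORM FLOOR without hypothesis

Part Q of the ROUND-37 plate (section `GlobalClosure`): Q1 `abTower_closed_global` — tangent flows of A–B objects are A–B objects with
the same `M`, the zooms converging in `L³(Q_R(0))` for EVERY `R > 0` (Part K's T1 engine re-run keeping the whole-space convergence);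
Q2 ★★ `ABTower.regPt_of_rateAt_small` (a local Type-I rate `ε < ε_L` at a final-time point of ANY A–B object forces regularity there —
NO hypothesis), `smallRateRegularityAB_small` / `smallRateRegularityB_small` (Part N's and Part O's small-rate hypotheses DISCHARGED for
every `ε < ε_L`); Q3 ★ `ABTower.epsL_le_tightRate'`, `ABTower.regPt_or_epsL_le'`, ★ `rootRate_trap'` (m_∞ ∈ [ε_L, M] along every infinite
root descent, no binder), ★ `epsL_le_minSingRate'`, `minSingRate_pos`.

PROVENANCE: declaration texts VERBATIM from the HOME plate of the instrument seat nsreg-p3 g26 (cell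
`pub/ns-regularity-ideate`): `round-37/Tangent37prep.lean` v11 (sha16 `f91e91ccf9664e4a`; = ROUND-36 plate v10
`ce225095590b75bd` VERBATIM + Part Q), memo `round-37/ROUND-37.md` 9d75f97f2a8a683a, scored by referee ref3 g26 (`SCORE-p3-ROUND-37-0828.md`); the
author cannot write under `Theorems/` (`perm.theorems-prover-only`); landed by the prover ns-es-p1 g5 as landing hand of record
(director-ns DIRECTOR-NS #237 (3)) as ONE module, namespace
`Summit.NavierStokesRegularity.NavierStokesRegularity.Cruxes.ScarEnvelopeTypeI.ZoomDictionary` (the plate's `NsregP3.R30P`, as in the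
landed dictionary / satellite-tower modules), `E3` spelled out, one-line docstrings added where the plate had none.
`--supports stmt-NavierStokesRegularity-23843 --as helper`.

HONEST FRAMING: ε-regularity / census INSTRUMENT on hypothetical Type-I zoom limits (Albritton–Barker objects).  Part Q removes
the hypothesis (T∞) of Part P from the floor theorems: `abTower_closed_global` re-exports Part K's closure engine (tree
compactness `local_typeI_compactness_twin_inBall`, whole-space) WITH the `L³(Q_R(0))`-convergence for every `R > 0`, and
`ABTower.regPt_of_rateAt_small` / `ABTower.epsL_le_tightRate'` / `rootRate_trap'` / `epsL_le_minSingRate'` carry NO hypothesis beyond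
the A–B class (uniform floor `ε_L = 1/(8·C₀(ℝ³))` of the singular rate, via the tree's PROVED `smallConstantLiouville_eq_zero`).
Qualitatively this is print ε-regularity in the Type-I box (Seregin 2014 p.101; Seregin–Zajaczkowski 2006; Takahashi 1990) read on the
census; the kernel object is new.  `GlobalTangents M` itself is NOT asserted.  NO open statement is proved — 23843
`TypeIQuarterGate.ScarEnvelopeTypeI`, S_C′, (E1⁺), (E2), (E2ᵣ), (L′), (S∞), (M𝐈₁), the route and Navier–Stokes regularity are OPEN.
-/

-- the summit-side namespace repeats a component by design (single-conjunct summit, D-0017)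
set_option linter.dupNamespace false

open MeasureTheory Set Metric Filter Topology
open scoped ENNReal NNReal InnerProductSpace
open Literature.Analysis.FluidPDE

namespace Summit.NavierStokesRegularity.NavierStokesRegularity.Cruxes.ScarEnvelopeTypeI.ZoomDictionary

section GlobalClosure

variable {U : ℝ → (EuclideanSpace ℝ (Fin 3)) → (EuclideanSpace ℝ (Fin 3))} {P : ℝ → (EuclideanSpace ℝ (Fin 3)) → ℝ}

open Summit.NavierStokesRegularity.NavierStokesRegularity.Theorems (smallConstantLiouville_eq_zero)

/-- **Q1 (the closure engine, whole-space export).**  For an A–B object `(U, P, H)` and a tangent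
flow `Ū` at `(0, y')` along null scales `L`: there are an A–B object `(U', P', H')` and a subsequence
`σ` with `Ū = U'` a.e. on every `Q_R(0)`, `R < 1`, `U' ∈ L³(Q_R(0))` and
`zoom U y' 0 (L (σ j)) → U'` in `L³(Q_R(0))` for EVERY `R > 0`. -/
theorem abTower_closed_global {M : ℝ} {H : ℝ → (EuclideanSpace ℝ (Fin 3)) → (EuclideanSpace ℝ (Fin 3)) →L[ℝ] (EuclideanSpace ℝ (Fin 3))} (h : ABTower M U P H) {y' : (EuclideanSpace ℝ (Fin 3))}
    {L : ℕ → ℝ} {Ū : ℝ → (EuclideanSpace ℝ (Fin 3)) → (EuclideanSpace ℝ (Fin 3))} (ht : TangentU U P y' 0 L Ū) :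
    ∃ (U' : ℝ → (EuclideanSpace ℝ (Fin 3)) → (EuclideanSpace ℝ (Fin 3))) (P' : ℝ → (EuclideanSpace ℝ (Fin 3)) → ℝ) (H' : ℝ → (EuclideanSpace ℝ (Fin 3)) → (EuclideanSpace ℝ (Fin 3)) →L[ℝ] (EuclideanSpace ℝ (Fin 3))) (σ : ℕ → ℕ),
      StrictMono σ ∧ ABTower M U' P' H' ∧
      (∀ R ∈ Ioo (0 : ℝ) 1, ∀ᵐ z ∂(volume.restrict (parabolicCylinder R (0 : ℝ × (EuclideanSpace ℝ (Fin 3))))),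
        Ū z.1 z.2 = U' z.1 z.2) ∧
      (∀ R : ℝ, 0 < R → MemLp (Function.uncurry U') 3
        (volume.restrict (parabolicCylinder R (0 : ℝ × (EuclideanSpace ℝ (Fin 3)))))) ∧
      (∀ R : ℝ, 0 < R → Tendsto (fun j => eLpNorm
        (Function.uncurry (zoom U y' 0 (L (σ j))) - Function.uncurry U') 3
        (volume.restrict (parabolicCylinder R (0 : ℝ × (EuclideanSpace ℝ (Fin 3)))))) atTop (𝓝 0)) := by
  obtain ⟨hmild, hIB, hH, hI⟩ := h
  obtain ⟨hL, hL0, pbar, hTR⟩ := ht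
  have hdec : HasTypeITimeDecay M U := hmild.2.2.2
  have hM : 0 ≤ M := by
    have h := hdec (-1) (by norm_num) 0
    rw [neg_neg, Real.sqrt_one, div_one] at h
    exact (norm_nonneg _).trans h
  have hcc_pos : ∀ m : ℕ, (0 : ℝ) < (2 : ℝ) ^ m := fun m => by positivity
  set I₀ : ℝ≥0∞ := typeIBound (Iio (0 : ℝ) ×ˢ univ) U P H with hI₀def
  set z₀ : ℝ × (EuclideanSpace ℝ (Fin 3)) := ((0 : ℝ), y') with hz₀def
  have hz1 : z₀.1 = 0 := by rw [hz₀def]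
  have hz2 : z₀.2 = y' := by rw [hz₀def]
  have hz₀sub : ∀ ρ : ℝ, parabolicCylinder ρ z₀ ⊆ Iio (0 : ℝ) ×ˢ (univ : Set (EuclideanSpace ℝ (Fin 3))) := fun ρ =>
    parabolicCylinder_subset_lowerHalf ρ y'
  have hQsl : ∀ ρ : ℝ, (parabolicCylinderOpens ρ z₀ : TopologicalSpace.Opens (ℝ × (EuclideanSpace ℝ (Fin 3)))) ≤
      slab (EuclideanSpace ℝ (Fin 3)) (Iio 0) isOpen_Iio := fun ρ w hw => hz₀sub ρ hw
  -- ## the zoomed triples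
  set v : ℕ → ℝ → (EuclideanSpace ℝ (Fin 3)) → (EuclideanSpace ℝ (Fin 3)) := fun k => L k • stPull (L k ^ 2) (L k) z₀.1 z₀.2 U with hvdef
  set q : ℕ → ℝ → (EuclideanSpace ℝ (Fin 3)) → ℝ := fun k => L k ^ 2 • stPull (L k ^ 2) (L k) z₀.1 z₀.2 P with hqdef
  set Gz : ℕ → ℝ → (EuclideanSpace ℝ (Fin 3)) → (EuclideanSpace ℝ (Fin 3)) →L[ℝ] (EuclideanSpace ℝ (Fin 3)) :=
    fun k => L k ^ 2 • stPull (L k ^ 2) (L k) z₀.1 z₀.2 H with hGzdef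
  -- the class on every `Q(0, 2ᵐ)`
  have hballs : ∀ m k : ℕ, IsSuitableWeakSolutionInBall ((2 : ℝ) ^ m) 0 (v k) (q k) := by
    intro m k
    set ρ : ℝ := (2 : ℝ) ^ m * L k with hρ
    have hρ0 : 0 < ρ := mul_pos (hcc_pos m) (hL k)
    have hsub : parabolicCylinder ρ z₀ ⊆ parabolicCylinder (‖y'‖ + ρ) (0 : ℝ × (EuclideanSpace ℝ (Fin 3))) :=
      parabolicCylinder_subset_zero (pow_le_pow_left₀ hρ0.le (by linarith [norm_nonneg y']) 2)
        le_rfl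
    have h0 : IsSuitableWeakSolutionInBall ρ z₀ U P :=
      (hIB (‖y'‖ + ρ) (by positivity)).of_subset_zero (z := z₀) hρ0 hsub
    have h1 := h0.zoom hρ0
    set c : ℝ := L k / ρ with hc
    have hc0 : 0 < c := div_pos (hL k) hρ0
    have h2 := h1.zoomOut hc0
    have hcρ : c * ρ = L k := div_mul_cancel₀ _ hρ0.ne'
    have hrad : 1 / c = (2 : ℝ) ^ m := by
      rw [hc, one_div_div, hρ, mul_div_cancel_right₀ _ (hL k).ne']
    rw [zoom_zoom, zoom_zoom, hcρ, hrad, show c ^ 2 * ρ ^ 2 = L k ^ 2 by rw [← hcρ]; ring] at h2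
    exact h2
  -- the weak gradients
  have hgrads : ∀ m k : ℕ,
      HasWeakSpatialGradientOn (parabolicCylinderOpens ((2 : ℝ) ^ m) (0 : ℝ × (EuclideanSpace ℝ (Fin 3)))) (v k) (Gz k) := by
    intro m k
    set ρ : ℝ := (2 : ℝ) ^ m * L k with hρ
    have hρL : ρ / L k = (2 : ℝ) ^ m := by rw [hρ, mul_div_cancel_right₀ _ (hL k).ne']
    have h1 := (hH.mono (hQsl ρ)).stRescale (L k) (β := L k ^ 2) (γ := L k) (pow_pos (hL k) 2)
      (hL k) z₀.1 z₀.2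
    have hpre : stPreimage (L k ^ 2) (L k) z₀.1 z₀.2 (parabolicCylinderOpens ρ z₀) =
        parabolicCylinderOpens ((2 : ℝ) ^ m) (0 : ℝ × (EuclideanSpace ℝ (Fin 3))) := by
      refine TopologicalSpace.Opens.ext ?_
      have e := zoom_preimage_parabolicCylinder (hL k) z₀ ρ
      rw [hρL] at e
      exact e
    rw [show L k * L k = L k ^ 2 by ring, hpre] at h1
    exact h1
  -- the Type I bound
  have hIs : ∀ m k : ℕ,
      typeIBound (parabolicCylinder ((2 : ℝ) ^ m) (0 : ℝ × (EuclideanSpace ℝ (Fin 3)))) (v k) (q k) (Gz k) ≤ I₀ := by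
    intro m k
    set ρ : ℝ := (2 : ℝ) ^ m * L k with hρ
    have hρL : ρ / L k = (2 : ℝ) ^ m := by rw [hρ, mul_div_cancel_right₀ _ (hL k).ne']
    refine le_trans ?_ (typeIBound_mono (hz₀sub ρ))
    rw [← typeIBound_nsZoom (hL k) z₀.1 z₀.2 (parabolicCylinder ρ z₀) U P H,
      zoom_preimage_parabolicCylinder (hL k) z₀ ρ, hρL]
  -- ## compactness with the class on all balls (tree)
  obtain ⟨Ut, Pt, Ht, σ, hσ, hIBU, hswU, hHU, h4I, hmemU, hconvU, -⟩ :=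
    Summit.NavierStokesRegularity.NavierStokesRegularity.Cruxes.ScarEnvelopeTypeI.SliceBudget.local_typeI_compactness_twin_inBall
      I₀ v q Gz hI (fun m k _ => hballs m k) (fun m k _ => hgrads m k) (fun m k _ => hIs m k)
  have h4Itop : typeIBound (Iio (0 : ℝ) ×ˢ univ) Ut Pt Ht < ⊤ :=
    lt_of_le_of_lt h4I (ENNReal.mul_lt_top (by simp) hI)
  -- ## the rate: on the zooms everywhere, on the limit a.e.
  have hratev : ∀ (k : ℕ) (s : ℝ) (y : (EuclideanSpace ℝ (Fin 3))), s < 0 → ‖v k s y‖ ≤ M / Real.sqrt (-s) := by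
    intro k s y hs
    have hL2 : 0 < L k ^ 2 := pow_pos (hL k) 2
    have hL2s : L k ^ 2 * s < 0 := mul_neg_of_pos_of_neg hL2 hs
    have h := hdec _ hL2s (y' + L k • y)
    have hsq : Real.sqrt (-(L k ^ 2 * s)) = L k * Real.sqrt (-s) := by
      rw [show -(L k ^ 2 * s) = L k ^ 2 * (-s) by ring, Real.sqrt_mul (sq_nonneg _),
        Real.sqrt_sq (hL k).le]
    rw [hsq] at h
    have hspos : 0 < Real.sqrt (-s) := Real.sqrt_pos.2 (by linarith)
    show ‖(L k • stPull (L k ^ 2) (L k) z₀.1 z₀.2 U) s y‖ ≤ M / Real.sqrt (-s)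
    rw [smul_stPull_apply, hz1, hz2, zero_add, norm_smul, Real.norm_of_nonneg (hL k).le,
      le_div_iff₀ hspos]
    have h' := (le_div_iff₀ (mul_pos (hL k) hspos)).1 h
    calc L k * ‖U (L k ^ 2 * s) (y' + L k • y)‖ * Real.sqrt (-s)
        = ‖U (L k ^ 2 * s) (y' + L k • y)‖ * (L k * Real.sqrt (-s)) := by ring
      _ ≤ M := h'
  have hrate_ae : ∀ᵐ w ∂(volume.restrict (Iio (0 : ℝ) ×ˢ (univ : Set (EuclideanSpace ℝ (Fin 3))))),
      ‖Ut w.1 w.2‖ ≤ M / Real.sqrt (-w.1) := by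
    have hQ : ∀ m : ℕ, ∀ᵐ w ∂(volume.restrict (parabolicCylinder ((2 : ℝ) ^ m) (0 : ℝ × (EuclideanSpace ℝ (Fin 3))))),
        ‖Ut w.1 w.2‖ ≤ M / Real.sqrt (-w.1) := by
      intro m
      have hmeas : ∀ j, AEStronglyMeasurable (Function.uncurry (v (σ j)))
          (volume.restrict (parabolicCylinder ((2 : ℝ) ^ m) (0 : ℝ × (EuclideanSpace ℝ (Fin 3))))) := fun j =>
        (hballs m (σ j)).1.distributional.1.aestronglyMeasurable
      obtain ⟨ψ, -, hae⟩ := exists_subseq_tendsto_ae₃ hmeas (hmemU _ (hcc_pos m)).1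
        (hconvU _ (hcc_pos m))
      filter_upwards [hae, ae_restrict_mem (isOpen_parabolicCylinder _ _).measurableSet]
        with w hw hwmem
      refine le_of_tendsto hw.norm (Eventually.of_forall fun i => ?_)
      have hw0 : w.1 < 0 := by
        have h1 := ((mem_parabolicCylinder).1 hwmem).1.2
        simpa using h1
      exact hratev _ w.1 w.2 hw0
    have hcover : (Iio (0 : ℝ) ×ˢ (univ : Set (EuclideanSpace ℝ (Fin 3)))) ⊆
        ⋃ m : ℕ, parabolicCylinder ((2 : ℝ) ^ m) (0 : ℝ × (EuclideanSpace ℝ (Fin 3))) := by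
      rintro ⟨t, x⟩ ⟨ht', -⟩
      obtain ⟨m, hm⟩ := exists_mem_parabolicCylinder_two_pow₃ (mem_Iio.1 ht') x
      exact mem_iUnion.2 ⟨m, hm⟩
    exact ae_restrict_of_ae_restrict_of_subset hcover ((ae_restrict_iUnion_iff _ _).2 hQ)
  -- ## representatives: the rate everywhere, then continuous Oseen-mild (KNSS)
  obtain ⟨U₁, hae₁, hdec₁⟩ := exists_repr_hasTypeITimeDecay hM hrate_ae
  have hae₁' : ∀ᵐ w ∂(volume.restrict ((slab (EuclideanSpace ℝ (Fin 3)) (Iio 0) isOpen_Iio :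
      TopologicalSpace.Opens (ℝ × (EuclideanSpace ℝ (Fin 3)))) : Set (ℝ × (EuclideanSpace ℝ (Fin 3))))), Function.uncurry Ut w = Function.uncurry U₁ w := by
    rw [coe_slab]
    exact hae₁
  have hsw₁ : IsSuitableWeakSolutionOn (slab (EuclideanSpace ℝ (Fin 3)) (Iio 0) isOpen_Iio) 1 0 U₁ Pt :=
    hswU.congr_ae hae₁' (ae_of_all _ fun _ => rfl)
  have hI₁ : typeIBound (Iio (0 : ℝ) ×ˢ univ) U₁ Pt Ht < ⊤ := by
    rwa [← typeIBound_congr_ae hae₁]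
  obtain ⟨U', hae₂, hUc, hUdiv, hUmild, hUrate⟩ :=
    exists_oseenMild_repr_of_typeIBound_lt_top hsw₁ hdec₁ hI₁
  have hae : ∀ᵐ w ∂(volume.restrict (Iio (0 : ℝ) ×ˢ (univ : Set (EuclideanSpace ℝ (Fin 3))))),
      Function.uncurry Ut w = Function.uncurry U' w := by
    filter_upwards [hae₁, hae₂] with w h1 h2
    rw [h1, h2]
  have hae' : ∀ᵐ w ∂(volume.restrict ((slab (EuclideanSpace ℝ (Fin 3)) (Iio 0) isOpen_Iio :
      TopologicalSpace.Opens (ℝ × (EuclideanSpace ℝ (Fin 3)))) : Set (ℝ × (EuclideanSpace ℝ (Fin 3))))), Function.uncurry Ut w = Function.uncurry U' w := by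
    rw [coe_slab]
    exact hae
  have hTI : IsTypeIAncientMild M U' :=
    LocalTypeIBlowup.isTypeIAncientMild_of_continuous_oseenMild_rate hUc hUdiv hUmild hUrate
  have hIBU' : ∀ a : ℝ, 0 < a → IsSuitableWeakSolutionInBall a (0 : ℝ × (EuclideanSpace ℝ (Fin 3))) U' Pt := fun a ha =>
    (hIBU a ha).congr_ae'
      (ae_restrict_of_ae_restrict_of_subset (parabolicCylinder_origin_subset_slab a) hae)
      (ae_of_all _ fun _ => rfl)
  have hHU' : HasWeakSpatialGradientOn (slab (EuclideanSpace ℝ (Fin 3)) (Iio 0) isOpen_Iio) U' Ht := hHU.congr_ae hae'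
  have hIU' : typeIBound (Iio (0 : ℝ) ×ˢ univ) U' Pt Ht < ⊤ := by
    rw [← typeIBound_congr_ae hae]
    exact h4Itop
  refine ⟨U', Pt, Ht, σ, hσ, ⟨hTI, hIBU', hHU', hIU'⟩, fun R hR => ?_, fun R hR => ?_, fun R hR => ?_⟩
  rotate_left
  · -- `U' ∈ L³(Q_R(0))` for every `R > 0`
    exact (hmemU R hR).ae_eq (ae_restrict_of_ae_restrict_of_subset (parabolicCylinder_origin_subset_slab R) hae)
  · -- whole-space `L³_loc` convergence of the zooms along `σ` to `U'`
    have haeR : ∀ᵐ w ∂(volume.restrict (parabolicCylinder R (0 : ℝ × (EuclideanSpace ℝ (Fin 3))))),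
        Function.uncurry Ut w = Function.uncurry U' w :=
      ae_restrict_of_ae_restrict_of_subset (parabolicCylinder_origin_subset_slab R) hae
    have hvz : ∀ k, zoom U y' 0 (L k) = v k := fun k => by
      simp only [hvdef, zoom_eq_smul_stPull, hz1, hz2]
    refine (hconvU R hR).congr' (Eventually.of_forall fun j => ?_)
    beta_reduce
    rw [hvz]
    exact eLpNorm_congr_ae (haeR.mono fun w hw => by simp only [Pi.sub_apply, hw])
  -- ## identification with the tangent flow on `Q_R(0)`, `R < 1`
  obtain ⟨hR0, hR1⟩ := hR
  obtain ⟨-, hŪmem, hconvŪ, -⟩ := hTR R ⟨hR0, hR1⟩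
  have hsubR : parabolicCylinder R (0 : ℝ × (EuclideanSpace ℝ (Fin 3))) ⊆ parabolicCylinder ((2 : ℝ) ^ 0) (0 : ℝ × (EuclideanSpace ℝ (Fin 3))) :=
    parabolicCylinder_mono hR0.le (by rw [pow_zero]; exact hR1.le) _
  have hμR : volume.restrict (parabolicCylinder R (0 : ℝ × (EuclideanSpace ℝ (Fin 3)))) ≤
      volume.restrict (parabolicCylinder ((2 : ℝ) ^ 0) (0 : ℝ × (EuclideanSpace ℝ (Fin 3)))) :=
    Measure.restrict_mono hsubR le_rfl
  have hmeasv : ∀ j, AEStronglyMeasurable (Function.uncurry (v (σ j)))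
      (volume.restrict (parabolicCylinder R (0 : ℝ × (EuclideanSpace ℝ (Fin 3))))) := fun j =>
    ((hballs 0 (σ j)).1.distributional.1.aestronglyMeasurable).mono_measure hμR
  have h1 : Tendsto (fun j => eLpNorm (Function.uncurry (v (σ j)) - Function.uncurry Ū) 3
      (volume.restrict (parabolicCylinder R (0 : ℝ × (EuclideanSpace ℝ (Fin 3)))))) atTop (𝓝 0) :=
    hconvŪ.comp hσ.tendsto_atTop
  have hae3 : Function.uncurry Ū =ᵐ[volume.restrict (parabolicCylinder R (0 : ℝ × (EuclideanSpace ℝ (Fin 3))))] Function.uncurry Ut :=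
    ae_eq_of_tendsto_eLpNorm_three hmeasv hŪmem.1 (hmemU R hR0).1 h1 (hconvU R hR0)
  have hae4 : ∀ᵐ w ∂(volume.restrict (parabolicCylinder R (0 : ℝ × (EuclideanSpace ℝ (Fin 3))))),
      Function.uncurry Ut w = Function.uncurry U' w :=
    ae_restrict_of_ae_restrict_of_subset (parabolicCylinder_origin_subset_slab R) hae
  filter_upwards [hae3, hae4] with w h3 h4
  exact h3.trans h4

/-- **Q2 ★★ (SMALL LOCAL TYPE-I RATE ⇒ REGULAR, absolute threshold, UNCONDITIONAL).** -/
theorem ABTower.regPt_of_rateAt_small {M ε : ℝ} {H : ℝ → (EuclideanSpace ℝ (Fin 3)) → (EuclideanSpace ℝ (Fin 3)) →L[ℝ] (EuclideanSpace ℝ (Fin 3))} (hT : ABTower M U P H)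
    {y' : (EuclideanSpace ℝ (Fin 3))} (hr : RateAt ε U y') (hε : ε < epsL) : RegPt U y' := by
  by_contra hy
  obtain ⟨L, Ū, hŪ⟩ := exists_tangentU_of_towerObj (towerObj_of_abTower hT) y'
  obtain ⟨U', P', H', σ, hσ, hT', hid, -, hconv'⟩ := abTower_closed_global hT hŪ
  obtain ⟨δ, hδ, hrate⟩ := hr
  have hLpos : ∀ k, 0 < L (σ k) := fun k => hŪ.1 (σ k)
  have hL0 : Tendsto (fun k => L (σ k)) atTop (𝓝 0) := hŪ.2.1.comp hσ.tendsto_atTop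
  have hcU : ContinuousOn (Function.uncurry U) (Iio 0 ×ˢ univ) := hT.1.1.continuousOn
  have hcU' : ContinuousOn (Function.uncurry U') (Iio 0 ×ˢ univ) := hT'.1.1.continuousOn
  -- the rate of `U'`, a.e. on every `Q_R(0)` along `σ`, then everywhere, then as a global decay
  have hae : ∀ R : ℝ, 0 < R → ∀ᵐ z ∂(volume.restrict (parabolicCylinder R (0 : ℝ × (EuclideanSpace ℝ (Fin 3))))),
      Real.sqrt (-z.1) * ‖U' z.1 z.2‖ ≤ ε := fun R hR => by
    have hmeasU' : AEStronglyMeasurable (Function.uncurry U')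
        (volume.restrict (parabolicCylinder R (0 : ℝ × (EuclideanSpace ℝ (Fin 3))))) :=
      (hcU'.mono (parabolicCylinder_subset_lowerHalf R (0 : (EuclideanSpace ℝ (Fin 3))))).aestronglyMeasurable
        (isOpen_parabolicCylinder R _).measurableSet
    exact rate_of_zooms hcU hLpos hL0 hR hmeasU' (hconv' R hR) hδ hrate
  have hall : ∀ R : ℝ, 0 < R → ∀ t ∈ Ioo (-(R ^ 2)) 0, ∀ x ∈ ball (0 : (EuclideanSpace ℝ (Fin 3))) R,
      Real.sqrt (-t) * ‖U' t x‖ ≤ ε := fun R hR => rate_everywhere_of_ae hcU' (hae R hR)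
  have hdec : HasTypeITimeDecay ε U' := hasTypeITimeDecay_of_rates hall
  have hmild : IsTypeIAncientMild ε U' := ⟨hT'.1.1, hT'.1.2.1, hT'.1.2.2.1, hdec⟩
  -- Liouville: the representative vanishes
  have hzero : ∀ t < 0, ∀ x, U' t x = 0 := fun t ht x => smallConstantLiouville_eq_zero hmild hε ht x
  -- hence the tangent flow itself is regular at the origin (a.e. identification on `Q_{1/2}(0)`)
  have hregU : RegPt Ū 0 := by
    refine ⟨1 / 2, by norm_num, 0, ?_⟩
    have hid' := hid (1 / 2) ⟨by norm_num, by norm_num⟩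
    rw [Prod.mk_zero_zero]
    filter_upwards [hid', ae_restrict_mem (isOpen_parabolicCylinder _ _).measurableSet]
      with z hz hzmem
    have hz0 : z.1 < 0 := by
      have h1 := ((mem_parabolicCylinder).1 hzmem).1.2
      simpa using h1
    rw [hz, hzero z.1 hz0 z.2, norm_zero]
  -- persistence of the singularity down the tangent flow (L8): contradiction
  exact (towerObj_of_abTower hT).not_regPt_tangentU_zero hy hŪ hregU

/-- **Q3a (Part N's hypothesis, A–B form, UNCONDITIONAL for every `ε < ε_L`).** -/
theorem smallRateRegularityAB_small {M ε : ℝ} (hε : ε < epsL) : SmallRateRegularityAB M ε :=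
  fun _ _ _ hT _ hr => hT.regPt_of_rateAt_small hr hε

/-- **Q3b ★ (THE UNIFORM FLOOR OF THE RATE LADDER, UNCONDITIONAL).**  At a singular final-time point
of ANY A–B object of ANY class `M`: `tightRate ≥ ε_L = 1/(8·C₀(ℝ³))`. -/
theorem ABTower.epsL_le_tightRate' {M : ℝ} {H : ℝ → (EuclideanSpace ℝ (Fin 3)) → (EuclideanSpace ℝ (Fin 3)) →L[ℝ] (EuclideanSpace ℝ (Fin 3))}
    (hT : ABTower M U P H) {y' : (EuclideanSpace ℝ (Fin 3))} (hy : ¬ RegPt U y') : epsL ≤ tightRate U y' := by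
  by_contra hlt
  have hlt' : tightRate U y' < epsL := lt_of_not_ge hlt
  set ε : ℝ := (tightRate U y' + epsL) / 2 with hεdef
  have h1 : tightRate U y' < ε := by rw [hεdef]; linarith
  have h2 : ε < epsL := by rw [hεdef]; linarith
  exact hy (hT.regPt_of_rateAt_small ((towerObj_of_abTower hT).rateAt_of_tightRate_lt h1) h2)

/-- The singular/regular dichotomy with the absolute gap, unconditional. -/
theorem ABTower.regPt_or_epsL_le' {M : ℝ} {H : ℝ → (EuclideanSpace ℝ (Fin 3)) → (EuclideanSpace ℝ (Fin 3)) →L[ℝ] (EuclideanSpace ℝ (Fin 3))}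
    (hT : ABTower M U P H) (y' : (EuclideanSpace ℝ (Fin 3))) : RegPt U y' ∨ epsL ≤ tightRate U y' := by
  by_cases hy : RegPt U y'
  · exact Or.inl hy
  · exact Or.inr (hT.epsL_le_tightRate' hy)

/-- **Q3c ★ (THE TRAP, UNCONDITIONAL).**  Along an infinite root descent the tight root rates decrease
to a limit `m_∞ ∈ [ε_L, M]` — Part N's `rootRate_trap` with NO hypothesis. -/
theorem rootRate_trap' {M : ℝ} {c : ℕ → TNode}
    (hc : ∀ k, RootObj M (c k) ∧ ¬ TameRoot (c k) ∧ RootDescends (c k) (c (k + 1))) :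
    ∃ m : ℝ, m ∈ Icc epsL M ∧ Antitone (fun k => tightRate (c k).U 0) ∧
      (∀ k, tightRate (c k).U 0 ∈ Icc m M) ∧
      Tendsto (fun k => tightRate (c k).U 0) atTop (𝓝 m) := by
  obtain ⟨m, hm, hle, ht⟩ := rootRate_tendsto hc
  have hε : ∀ k, epsL ≤ tightRate (c k).U 0 := fun k =>
    (hc k).1.1.epsL_le_tightRate' (hc k).1.2
  exact ⟨m, ⟨ge_of_tendsto' ht hε, hm.2⟩, rootRate_antitone hc,
    fun k => ⟨hle k, (rootRate_mem_Icc hc k).2⟩, ht⟩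

/-- **Q3d ★ (THE MINIMAL SINGULAR RATE IS AT LEAST `ε_L`, UNCONDITIONAL, uniform in `M`).** -/
theorem epsL_le_minSingRate' {M : ℝ} (hne : (singRates M).Nonempty) : epsL ≤ minSingRate M :=
  le_csInf hne fun _ ⟨_, _, _, _, hAB, hy, hr⟩ => hr ▸ hAB.epsL_le_tightRate' hy

/-- The class-wide minimal singular rate is positive whenever some scar exists (NO hypothesis): `0 < m_*(M)`. -/
theorem minSingRate_pos {M : ℝ} (hne : (singRates M).Nonempty) : 0 < minSingRate M :=
  epsL_pos.trans_le (epsL_le_minSingRate' hne)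

/-- **Q3e ((T∞)'s load-bearing content holds).**  ROUND-36's hypothesis-shaped consequences all hold:
`SmallRateRegularityAB M ε` for every `ε < ε_L` is now a theorem, so Part P applies with
`smallRateRegularityAB_small` in place of `smallRateRegularityAB_of_globalTangents hG`. -/
theorem smallRateRegularityB_small {M ε : ℝ} (hε : ε < epsL) (I : ℝ) : SmallRateRegularityB M I ε :=
  (smallRateRegularityAB_small hε).toB I

end GlobalClosure

end Summit.NavierStokesRegularity.NavierStokesRegularity.Cruxes.ScarEnvelopeTypeI.ZoomDictionary
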